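import Mathlib
import HarnessLib
import Summits.HubbardSuperconductivity.HubbardSuperconductivity.Theorems.KLProgrammeKLRegimeCountertermJacksonRemainderCertAnFrame
import Summits.HubbardSuperconductivity.HubbardSuperconductivity.Theorems.KLProgrammeKLRegimeCountertermJacksonRemainderReadResidueC1

/-!
# (C1) ANALYTIC CERTIFICATE at deep scales, part 6 — THE ONE-CALL (C1) DOOR AT STUB (C)'s BINDERS FOR **EVERY** READING SCALE
# (`readResidueC1_jets_analytic_klEng`: the deep twin of k3c3-p1's `readResidueC1_jets_of_certFrame_klEng`, same hypothesis list, no `n + 1 ≤ 4`)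

Cell `gate-hubbard-kl`, seat hubbard-kl-k3c3-p3 (g12), `--supports stmt-HubbardSuperconductivity-20437` (stub (C) of `KLRegimeEngineV17F2`),
located item «(C1)-DEEP-AN» / «(C1)-FLOW-INSTANCE-6+» (pen (R79g/h): ONE door name per branch, identical hypothesis lists, hJ currency =
`readResidue_flow_hP`'s).  k3c3-p1's `readResidueC1_jets_of_certFrame_klEng` (…ReadResidueC1) is keyed by the kit tables (`CutoffDefectCertFrame
(klFlowDeg n) klC1FrameAF<d> klC1TableF<d>`, `n + 1 ≤ 4`).  This file supplies the same conclusions at EVERY `n` from the ANALYTIC certificate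
`cutoffDefectCertFrame_analytic_klwjA` (…CertAnFrame) with the flow frame's own size table
`A(n+1) = ((16/15)Gfr₀|U|, (4/3)Gfr₁U², Gfr₂·c/log 4, (Gfr₃/3)U²4^{n+1}, (Gfr₄/15)U²16^{n+1})` (k3c3-p3 `flowFrame_sizes_closed` /
`flowFrame_size_two_regime` from the history `FlowPieceJetsAt … m`, `m ≤ n`, and the regime `IsKLRegime U c (−(n+1))` for the flat row), whose
low rows are `≤ 2⁻¹¹⁹ ≤ 10⁻⁹` below `klEngU₀9` / `klEngC₃6` (k3c3-p1 `gfr_mul_le_of_le_klEngU₀4`).  Output: `J ∈ C⁴`, `|J| ≤ a₁Td + a₀N0`,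
`|∂ᵏJ| ≤ T.bound a k` (`k ≤ 3`), `|∂ᵏJ| ≤ T.boundNR a k` (`k ≤ 4`) with `T = klC1TableAn (klFlowDeg n) δ₀ 1.8289 1.688 D_A(n+1)` — the table of
record for the branch `n ≥ 5` (and valid at every `n`).  The window certificate `KlwjCertA` (k3c3-p3 g7 / c4a-1) stays a named hypothesis, as
in c4a-1's `hJjet_cert`.

Assembly only; no definitions; nothing here asserts stub (C), K3 or superconductivity.
-/

noncomputable section

namespace Summit.HubbardSuperconductivity.HubbardSuperconductivity.Theorems.KLRegimeSplit

set_option linter.dupNamespace false -- summit = problem name (single-conjunct summit), D-0017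

open Real Set
open Literature.MathematicalPhysics.QuantumLattice Literature.Probability.LatticeModels
open Literature.MathematicalPhysics.QuantumLattice.BandSectorCounting
open Summit.HubbardSuperconductivity.HubbardSuperconductivity.Theorems.PerturbedFermiCurve
open Summit.HubbardSuperconductivity.HubbardSuperconductivity.Theorems.EngineV8
open Summit.HubbardSuperconductivity.HubbardSuperconductivity.Theorems.DispersionFlow

/-! ## §1 The flow frame's size table and its smallness below the stub's thresholds -/

section Sizes

variable {L M : ℕ} [NeZero L] [NeZero M]

/-- **The flow frame's size table** at `K_{n+1}` from the history and the regime: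
`‖Dʲ(K_{n+1} ∘ ofLp)‖ ≤ A(n+1) j = ((16/15)Gfr₀|U|, (4/3)Gfr₁U², Gfr₂·c/log 4, (Gfr₃/3)U²4^{n+1}, (Gfr₄/15)U²16^{n+1})`. -/
theorem flowFrame_sizes_table {R : RenConsts} (hR : ∀ j, 0 ≤ R.Gfr j) {c β U μ : ℝ} {n : ℕ}
    (hist : ∀ m < n + 1, FlowPieceJetsAt L M β U μ R m) (hreg : IsKLRegime U c (-((n + 1 : ℕ) : ℤ))) :
    ∀ j ≤ 4, ∀ p : EuclideanSpace ℝ (Fin 2),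
      ‖iteratedFDeriv ℝ j (fun q : EuclideanSpace ℝ (Fin 2) => (klFlowFrameU L M β U μ (n + 1)).eval (WithLp.ofLp q)) p‖ ≤
        (fun j : ℕ => if j = 0 then 16 / 15 * R.Gfr 0 * |U| else if j = 1 then 4 / 3 * R.Gfr 1 * U ^ 2
          else if j = 2 then R.Gfr 2 * (c / Real.log 4) else if j = 3 then R.Gfr 3 / 3 * U ^ 2 * 4 ^ (n + 1)
          else R.Gfr 4 / 15 * U ^ 2 * 16 ^ (n + 1)) j := by
  intro j hj p
  have e : (fun q : EuclideanSpace ℝ (Fin 2) => (klFlowFrameU L M β U μ (n + 1)).eval (WithLp.ofLp q)) =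
      evalM (klFlowFrameU L M β U μ (n + 1)) := rfl
  rw [e]
  obtain ⟨h0, h1, -, h3, h4⟩ := flowFrame_sizes_closed (L := L) (M := M) (β := β) (μ := μ) (n := n + 1) hR hist p
  have h2 := flowFrame_size_two_regime (L := L) (M := M) (β := β) (μ := μ) (n := n + 1) hR hist hreg p
  interval_cases j
  · simpa using h0
  · simpa using h1
  · simpa using h2
  · simpa using h3
  · simpa using h4

/-- **Smallness of the low rows below the stub's binders**: `R.WF`, `0 < U ≤ klEngU₀9 P R c`, `0 < c ≤ klEngC₃6 P R` ⟹
`(16/15)Gfr₀|U| ≤ 10⁻⁹`, `(4/3)Gfr₁U² ≤ 10⁻⁹`, `Gfr₂·c/log 4 ≤ 10⁻⁹`. -/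
theorem flowFrame_lowRows_le {P : SplitConsts} {R : RenConsts} (hRW : R.WF) {c U : ℝ} (hc : 0 < c) (hc6 : c ≤ klEngC₃6 P R) (hU : 0 < U)
    (hU9 : U ≤ klEngU₀9 P R c) :
    16 / 15 * R.Gfr 0 * |U| ≤ 1 / 10 ^ 9 ∧ 4 / 3 * R.Gfr 1 * U ^ 2 ≤ 1 / 10 ^ 9 ∧ R.Gfr 2 * (c / Real.log 4) ≤ 1 / 10 ^ 9 := by
  have hR : ∀ j, 0 ≤ R.Gfr j := hRW.2.2
  have hU4 : U ≤ klEngU₀4 P R c := hU9.trans (klEngU₀9_le_klEngU₀4 P R c)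
  have hg0 : R.Gfr 0 * U ≤ 1 / 2 ^ 127 := gfr_mul_le_of_le_klEngU₀4 hRW hU4 (by norm_num)
  have hg1 : R.Gfr 1 * U ≤ 1 / 2 ^ 127 := gfr_mul_le_of_le_klEngU₀4 hRW hU4 (by norm_num)
  have hU1 : U ≤ 1 := by
    have h' := hU4.trans (klEngU₀4_le_inv_gfr_add_one P hRW c (show 0 < 5 by norm_num))
    have hG0 := hR 0
    exact h'.trans (by rw [div_le_one (by linarith)]; linarith)
  refine ⟨?_, ?_, ?_⟩
  · rw [abs_of_pos hU]
    calc 16 / 15 * R.Gfr 0 * U = 16 / 15 * (R.Gfr 0 * U) := by ring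
      _ ≤ 16 / 15 * (1 / 2 ^ 127) := by gcongr
      _ ≤ 1 / 10 ^ 9 := by norm_num
  · have hG1 := hR 1
    calc 4 / 3 * R.Gfr 1 * U ^ 2 ≤ 4 / 3 * R.Gfr 1 * U := by
          have : U ^ 2 ≤ U := by nlinarith
          gcongr
      _ = 4 / 3 * (R.Gfr 1 * U) := by ring
      _ ≤ 4 / 3 * (1 / 2 ^ 127) := by gcongr
      _ ≤ 1 / 10 ^ 9 := by norm_num
  · -- the flat row: `Gfr₂·c ≤ Rsq/(2¹²⁰·Psq·Rsq²) ≤ 2⁻¹²⁰`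
    have hc3 : c ≤ klEngC₃3 P R := hc6.trans (klEngC₃6_le_klEngC₃3 P R)
    have hP1 : 1 ≤ klEngPsq P := one_le_klEngPsq P
    have hR1 : 1 ≤ klEngRsq R := one_le_klEngRsq R
    have hG2 : R.Gfr 2 ≤ klEngRsq R := gfr_le_klEngRsq R (by norm_num)
    have hG2' := hR 2
    have hcR : R.Gfr 2 * c ≤ 1 / 2 ^ 120 := by
      have h1 : R.Gfr 2 * c ≤ klEngRsq R * klEngC₃3 P R := mul_le_mul hG2 hc3 hc.le (by linarith)
      refine h1.trans ?_
      unfold klEngC₃3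
      rw [mul_one_div, div_le_div_iff₀ (by positivity) (by positivity), one_mul]
      have : klEngRsq R * (2 : ℝ) ^ 120 ≤ (2 : ℝ) ^ 120 * klEngPsq P * klEngRsq R ^ 2 := by
        have h2 : klEngRsq R ≤ klEngPsq P * klEngRsq R ^ 2 := by nlinarith
        nlinarith
      linarith
    have one_le_log_four : (1 : ℝ) ≤ Real.log 4 := by
      rw [← Real.log_exp 1]
      exact Real.log_le_log (Real.exp_pos 1) (by have := Real.exp_one_lt_d9; norm_num at this ⊢; linarith)
    calc R.Gfr 2 * (c / Real.log 4) ≤ R.Gfr 2 * c := by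
          apply mul_le_mul_of_nonneg_left _ hG2'
          exact div_le_self hc.le one_le_log_four
      _ ≤ 1 / 2 ^ 120 := hcR
      _ ≤ 1 / 10 ^ 9 := by norm_num

end Sizes

/-! ## §2 The deep twin of the one-call door -/

section Stub

variable {L M : ℕ} [NeZero L] [NeZero M]

/-- **THE (C1) DOOR AT STUB (C)'s BINDERS, ONE CALL, EVERY READING SCALE** (deep twin of `readResidueC1_jets_of_certFrame_klEng`).  From `R.WF`,
`0 < c ≤ klEngC₃6 P R`, `μ ∈ klWindowC`, `0 < U ≤ klEngU₀9 P R c`, `klBetaMin ≤ β ≤ e^{c/U²}`, the regime at the reading scale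
`IsKLRegime U c (−(n+1))`, the new flow frame admissible (`FrameOK R U (nScales β) μ K_{n+1}`), the history's flow-piece jets
(`FlowPieceJetsAt … m`, `m ≤ n`), the window certificate `KlwjCertA`, a near half-width `0 < δ₀ ≤ 1` with `4δ₀ + 10⁻⁹ ≤ klFlatR`, and the `C⁴`
induction hypothesis in natural-size form: the (C1) bracket `J = ν_n(K_n) − (klFlowPiece n).eval∘k_F^{K_{n+1}}` is `C⁴` with
`|J| ≤ a₁·Td + a₀·N0`, `|∂ᵏJ| ≤ T.bound a k` (`1 ≤ k ≤ 3`), `|∂ᵏJ| ≤ T.boundNR a k` (`1 ≤ k ≤ 4`) at every angle, for the ANALYTIC table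
`T = klC1TableAn (klFlowDeg n) δ₀ 1.8289 1.688 D_A(n+1)`. -/
theorem readResidueC1_jets_analytic_klEng (hT : KlwjCertA) {P : SplitConsts} {R : RenConsts} (hRW : R.WF) {c : ℝ} (hc : 0 < c)
    (hc6 : c ≤ klEngC₃6 P R) {μ : ℝ} (hμ : μ ∈ klWindowC) {U : ℝ} (hU : 0 < U) (hU9 : U ≤ klEngU₀9 P R c) {β : ℝ}
    (hβmin : klBetaMin ≤ β) (hβc : β ≤ Real.exp (c / U ^ 2)) {n : ℕ} (hreg : IsKLRegime U c (-((n + 1 : ℕ) : ℤ)))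
    (hK : FrameOK R U (nScales β) μ (klFlowFrameU L M β U μ (n + 1))) (hist : ∀ m < n + 1, FlowPieceJetsAt L M β U μ R m)
    {δ₀ : ℝ} (hδ₀ : 0 < δ₀) (hδ₁ : δ₀ ≤ 1) (hnear : 4 * δ₀ + 1 / 10 ^ 9 ≤ klFlatR)
    (hf : ContDiff ℝ 4 fun θ : ℝ => klLocalPart L M β U μ (klFlowFrameU L M β U μ n) n θ)
    {a : ℕ → ℝ} (ha_nn : ∀ l, 0 ≤ a l)
    (ha0 : ∀ x, |klLocalPart L M β U μ (klFlowFrameU L M β U μ n) n x -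
      klAngularMean (fun θ => klLocalPart L M β U μ (klFlowFrameU L M β U μ n) n θ)| ≤ a 0)
    (ha : ∀ l, 1 ≤ l → l ≤ 4 → ∀ x, |iteratedDeriv l (fun x => klLocalPart L M β U μ (klFlowFrameU L M β U μ n) n x) x| ≤ a l) :
    let T : CutoffDefectTable := klC1TableAn (klFlowDeg n) δ₀ 1.8289 1.688
      (fun i => if i = 1 then 4.31 else if i = 2 then 27 else if i = 3 then 297 + 971 * (R.Gfr 3 / 3 * U ^ 2 * 4 ^ (n + 1))
        else 8281 + 165600 * (R.Gfr 3 / 3 * U ^ 2 * 4 ^ (n + 1)) + 8400 * (R.Gfr 4 / 15 * U ^ 2 * 16 ^ (n + 1)))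
    ContDiff ℝ 4 (fun θ : ℝ => klLocalPart L M β U μ (klFlowFrameU L M β U μ n) n θ -
        (klFlowPiece L M β U μ n).eval (klFermiPoint μ (klFlowFrameU L M β U μ (n + 1)) θ)) ∧
    (∀ θ : ℝ, |klLocalPart L M β U μ (klFlowFrameU L M β U μ n) n θ -
        (klFlowPiece L M β U μ n).eval (klFermiPoint μ (klFlowFrameU L M β U μ (n + 1)) θ)| ≤ a 1 * T.Td + a 0 * T.N0) ∧
    (∀ k, 1 ≤ k → k ≤ 3 → ∀ θ : ℝ, |iteratedDeriv k (fun θ : ℝ => klLocalPart L M β U μ (klFlowFrameU L M β U μ n) n θ -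
        (klFlowPiece L M β U μ n).eval (klFermiPoint μ (klFlowFrameU L M β U μ (n + 1)) θ)) θ| ≤ T.bound a k) ∧
    (∀ k, 1 ≤ k → k ≤ 4 → ∀ θ : ℝ, |iteratedDeriv k (fun θ : ℝ => klLocalPart L M β U μ (klFlowFrameU L M β U μ n) n θ -
        (klFlowPiece L M β U μ n).eval (klFermiPoint μ (klFlowFrameU L M β U μ (n + 1)) θ)) θ| ≤ T.boundNR a k) := by
  intro T
  have hR : ∀ j, 0 ≤ R.Gfr j := hRW.2.2
  have hcle : c ≤ klCurveC3 R := hc6.trans ((klEngC₃6_le_klEngC₃3 P R).trans (klEngC₃3_le_klCurveC3 P hR))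
  have hUle : U ≤ klCurveU0 R := hU9.trans ((klEngU₀9_le_klEngU₀3 P R c).trans (klEngU₀3_le_klCurveU0 P hR c))
  -- the flow frame's size table and the low-row smallness
  set A : ℕ → ℝ := fun j => if j = 0 then 16 / 15 * R.Gfr 0 * |U| else if j = 1 then 4 / 3 * R.Gfr 1 * U ^ 2
    else if j = 2 then R.Gfr 2 * (c / Real.log 4) else if j = 3 then R.Gfr 3 / 3 * U ^ 2 * 4 ^ (n + 1)
    else R.Gfr 4 / 15 * U ^ 2 * 16 ^ (n + 1) with hAdef
  have hA := flowFrame_sizes_table (L := L) (M := M) (β := β) (μ := μ) hR hist hreg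
  obtain ⟨s0, s1, s2⟩ := flowFrame_lowRows_le hRW hc hc6 hU hU9
  have h0 : A 0 ≤ 1 / 10 ^ 9 := by simpa [hAdef] using s0
  have h1 : A 1 ≤ 1 / 10 ^ 9 := by simpa [hAdef] using s1
  have h2 : A 2 ≤ 1 / 10 ^ 9 := by simpa [hAdef] using s2
  have hA3 : 0 ≤ A 3 := by
    have h3 := hR 3
    have : A 3 = R.Gfr 3 / 3 * U ^ 2 * 4 ^ (n + 1) := by simp [hAdef]
    rw [this]; positivity
  have hA4 : 0 ≤ A 4 := by
    have h4 := hR 4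
    have : A 4 = R.Gfr 4 / 15 * U ^ 2 * 16 ^ (n + 1) := by simp [hAdef]
    rw [this]; positivity
  -- the analytic certificate for the flow frame's table at the piece's degree
  have hcert := cutoffDefectCertFrame_analytic_klwjA hT (klFlowDeg n) h0 h1 h2 hA3 hA4 hδ₀ hδ₁ hnear
  have eA3 : A 3 = R.Gfr 3 / 3 * U ^ 2 * 4 ^ (n + 1) := by simp [hAdef]
  have eA4 : A 4 = R.Gfr 4 / 15 * U ^ 2 * 16 ^ (n + 1) := by simp [hAdef]
  rw [eA3, eA4] at hcert
  exact readResidueC1_jets_of_certFrame hR hc hcle hU hUle hβmin hβc hμ hK rfl hcert hA hf ha_nn ha0 ha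

end Stub

end Summit.HubbardSuperconductivity.HubbardSuperconductivity.Theorems.KLRegimeSplit

end
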